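import Mathlib.Algebra.Module.Injective
import Mathlib.Algebra.EuclideanDomain.Int
import Mathlib.LinearAlgebra.Quotient.Basic
import Mathlib.LinearAlgebra.Span.Basic
import Mathlib.LinearAlgebra.Pi
import Mathlib.RingTheory.PrincipalIdealDomain
import Mathlib.Data.ZMod.Units
import Mathlib.GroupTheory.Subgroup.Center
import Mathlib.Algebra.BigOperators.Pi
import Mathlib.Tactic.Group
import Mathlib.Tactic.Abel
import Mathlib.Tactic.Ring
import HarnessLib

/-!
# Route ConvexRankGates, crux `Capture` (stmt-PneNP-2659), line `csp-spine-meet-to-join` (rev 5),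
# Stub Z `stub_centralCertificateZMod`: the CENTRAL CERTIFICATE over `ℤ/M`

The registered stub `stub_centralCertificateZMod` of the skeleton
`Cruxes/Capture/Lines/csp_spine_meet_to_join.lean` (continuation lead c2, worker W3, 2026-08-16).
It is the `ℤ/M`-version of the landed `𝔽₂` lemma `central_certificate'`
(`Theorems/ConvexRankGatesCaptureCentralCertificate.lean`), the group-theoretic engine behind the
capture of coset CSPs over class-2 groups by span programs.

**Statement.** Let `P` be a group, `e : Multiplicative Zadd →* P` a homomorphism from a
`ℤ/M`-module `Zadd` into the CENTRE of `P` (the central layer), `H j ≤ P` subgroups and `g j ∈ P`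
coset representatives (`j ∈ ι`, the selected constraints). Suppose the quotient instance modulo the
central layer is solvable, witnessed by `x₀ = g j * p₀ j * e (ζ₀ j)` with `p₀ j ∈ H j`, but no `y`
lies in every coset `g j • H j`. Then there are `ℤ/M`-linear functionals `θ j : Zadd → ℤ/M` and a
NONZERO `t : ℤ/M` such that (a) `θ j` kills the central elements of `H j`, (b) `∑ j, θ j = 0`
(the diagonal is killed), and (c) `∑ j, θ j (ζ j) = t` for EVERY lift `x = g j * p j * e (ζ j)`
(`p j ∈ H j`) of every solution of the quotient instance.

**Proof** (the argument of `central_certificate'`, verbatim up to the separation step). In the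
`ℤ/M`-module `ι → Zadd` the decomposition vectors of the elements of `⋂ j, H j · e(Zadd)` form an
additive submonoid `Gen` (products of lifts decompose coordinatewise because the layer is central),
`K = {t | ∃ z, ∀ j, e (t j + z) ∈ H j}` is one too, both are `ℤ/M`-submodules since
`c • t = c.val • t`, and unsolvability says `ζ₀ ∉ W := Gen ⊔ K`. SEPARATION: the class of `ζ₀` in
the quotient module `(ι → Zadd) ⧸ W` is nonzero, and every nonzero element of a `ℤ/M`-module is
detected by a `ℤ/M`-valued linear functional (`zmod_exists_linearMap_apply_ne_zero`: `ℤ/M` is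
self-injective by Baer's criterion, so a functional on the cyclic submodule through the element
extends) — this replaces `Submodule.exists_dual_map_eq_bot_of_notMem` of the field case. Composing
with the quotient map gives `f` killing `W` with `t := f ζ₀ ≠ 0`, and `θ j := f ∘ single j` is the
certificate: central parts and the diagonal lie in `K`, and `ζ - ζ₀ ∈ Gen` for every lift `ζ`.

The self-injectivity lemmas of section `SelfInjective` are adapted (shortened) from the refuter work
file `Cruxes/Capture/Disproof.lean` §20 (refuter cdisprove-stmt-PneNP-2659 g3), which is not an
importable module. [folklore]
-/

namespace Summit.PneNP.PneNP.Cruxes.Capture.CspSpineMeetToJoin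

set_option linter.dupNamespace false -- `Summit.PneNP.PneNP.…`: summit = sub-problem (D-0017)

open Multiplicative

/-! ## `ℤ/n` is self-injective: nonzero elements of `ℤ/n`-modules are detected by functionals -/

section SelfInjective
-- adapted from Cruxes/Capture/Disproof.lean §20 (refuter cdisprove-stmt-PneNP-2659 g3)

variable {n : ℕ} [NeZero n]

/-- Divisibility transfer in `ℤ/n`: if every `r` killing `d` kills `a`, then `a` is a multiple of `d`.
(Write `d = u d₀` with `u` a unit and `d₀ ∣ n` (`ZMod.eq_unit_mul_divisor`); `n / d₀` kills `d`,
hence `a`, so `d₀ ∣ a.val`.) [folklore] -/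
theorem zmod_exists_eq_mul_of_ann_le (d a : ZMod n) (h : ∀ r : ZMod n, r * d = 0 → r * a = 0) :
    ∃ c : ZMod n, a = d * c := by
  obtain ⟨d₀, ⟨n₀, hn₀⟩, u, hu, rfl⟩ := ZMod.eq_unit_mul_divisor d
  -- `n₀ = n / d₀` kills `u * d₀`, hence `a`
  have hka : ((n₀ * a.val : ℕ) : ZMod n) = 0 := by
    rw [Nat.cast_mul, ZMod.natCast_zmod_val]
    refine h _ ?_
    rw [mul_comm u, ← mul_assoc, ← Nat.cast_mul, mul_comm n₀, ← hn₀, ZMod.natCast_self, zero_mul]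
  rw [ZMod.natCast_eq_zero_iff] at hka
  obtain ⟨k, hk⟩ := hka
  have hn₀0 : 0 < n₀ := Nat.pos_of_ne_zero fun h0 => NeZero.ne n (by rw [hn₀, h0, mul_zero])
  have ha : a.val = d₀ * k := Nat.eq_of_mul_eq_mul_left hn₀0 (by rw [hk, hn₀]; ring)
  obtain ⟨v, hv⟩ := hu.exists_right_inv
  refine ⟨v * k, ?_⟩
  calc a = ((d₀ * k : ℕ) : ZMod n) := by rw [← ha, ZMod.natCast_zmod_val]
    _ = u * v * (d₀ * k) := by rw [hv, one_mul, Nat.cast_mul]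
    _ = u * d₀ * (v * k) := by ring

omit [NeZero n] in
/-- `ℤ/n` is a principal ideal ring (a quotient of `ℤ`). [folklore] -/
theorem zmod_isPrincipalIdealRing : IsPrincipalIdealRing (ZMod n) :=
  IsPrincipalIdealRing.of_surjective (Int.castRingHom (ZMod n)) (ZMod.ringHom_surjective _)

/-- **`ℤ/n` is self-injective** (Baer's criterion: a linear map from the ideal `(d)` sends `d` to a
multiple `d c` of `d` by `zmod_exists_eq_mul_of_ann_le`, so `x ↦ x c` extends it). [folklore] -/
theorem zmod_baer : Module.Baer (ZMod n) (ZMod n) := by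
  haveI : IsPrincipalIdealRing (ZMod n) := zmod_isPrincipalIdealRing
  intro I g
  obtain ⟨d, hd⟩ := (IsPrincipalIdealRing.principal I).principal
  have hdI : d ∈ I := by rw [hd]; exact Ideal.mem_span_singleton_self d
  obtain ⟨c, hc⟩ := zmod_exists_eq_mul_of_ann_le d (g ⟨d, hdI⟩) fun r hr => by
    have : r • g ⟨d, hdI⟩ = g (r • ⟨d, hdI⟩) := (g.map_smul r _).symm
    rw [smul_eq_mul] at this
    rw [this]
    have h0 : (r • ⟨d, hdI⟩ : I) = 0 := Subtype.ext (by simpa using hr)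
    rw [h0, map_zero]
  refine ⟨c • LinearMap.id, fun x hx => ?_⟩
  rw [hd] at hx
  obtain ⟨s, rfl⟩ := Ideal.mem_span_singleton'.1 hx
  have : g ⟨s * d, hd ▸ Ideal.mem_span_singleton'.2 ⟨s, rfl⟩⟩ = s • g ⟨d, hdI⟩ := by
    rw [← g.map_smul]; congr 1
  simp only [LinearMap.smul_apply, LinearMap.id_apply, smul_eq_mul]
  rw [this, smul_eq_mul, hc]
  ring

/-- **Every nonzero element of a `ℤ/n`-module is detected by a `ℤ/n`-linear functional.** The
annihilator of `q` is a principal ideal `(e)` with `e` a non-unit, so some `w ≠ 0` has `e w = 0`;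
`r ↦ w r` descends to `ℤ/n ⧸ (e) ≅ (ℤ/n) q` and extends to the whole module by `zmod_baer`.
[folklore] -/
theorem zmod_exists_linearMap_apply_ne_zero {Q : Type*} [AddCommGroup Q] [Module (ZMod n) Q]
    {q : Q} (hq : q ≠ 0) : ∃ φ : Q →ₗ[ZMod n] ZMod n, φ q ≠ 0 := by
  classical
  haveI : IsPrincipalIdealRing (ZMod n) := zmod_isPrincipalIdealRing
  let τ : ZMod n →ₗ[ZMod n] Q := LinearMap.toSpanSingleton (ZMod n) Q q
  have hτ1 : τ 1 = q := by simp [τ]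
  -- the annihilator of `q` is a principal ideal `(e)`
  obtain ⟨e, he⟩ := (IsPrincipalIdealRing.principal (LinearMap.ker τ)).principal
  -- a nonzero scalar `w` killed by `e`: otherwise `e` is a unit and `q = τ 1 = 0`
  obtain ⟨w, hwe, hw0⟩ : ∃ w : ZMod n, e * w = 0 ∧ w ≠ 0 := by
    by_contra hcon
    push Not at hcon
    obtain ⟨c, hc⟩ := zmod_exists_eq_mul_of_ann_le e 1 fun r hr => by
      rw [mul_one]; exact hcon r ((mul_comm e r).trans hr)
    have h1 : e * c ∈ LinearMap.ker τ := by
      rw [he]; exact Ideal.mul_mem_right _ _ (Ideal.mem_span_singleton_self _)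
    rw [← hc, LinearMap.mem_ker, hτ1] at h1
    exact hq h1
  -- `r ↦ w r` kills `ker τ = (e)`, so it descends to `ℤ/n ⧸ ker τ`
  let ψ₀ : ZMod n →ₗ[ZMod n] ZMod n := w • LinearMap.id
  have hK : LinearMap.ker τ ≤ LinearMap.ker ψ₀ := by
    intro r hr
    rw [he] at hr
    obtain ⟨s, rfl⟩ := Ideal.mem_span_singleton'.1 hr
    rw [LinearMap.mem_ker]
    simp only [ψ₀, LinearMap.smul_apply, LinearMap.id_apply, smul_eq_mul]
    calc w * (s * e) = s * (e * w) := by ring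
      _ = 0 := by rw [hwe, mul_zero]
  -- extend along the injection `ℤ/n ⧸ ker τ ↪ Q` by self-injectivity
  have hinj : Function.Injective ((LinearMap.ker τ).liftQ τ le_rfl) := by
    rw [← LinearMap.ker_eq_bot]
    exact Submodule.ker_liftQ_eq_bot _ _ _ le_rfl
  obtain ⟨φ, hφ⟩ := zmod_baer.extension_property _ hinj ((LinearMap.ker τ).liftQ ψ₀ hK)
  refine ⟨φ, ?_⟩
  have h1 := LinearMap.congr_fun hφ (Submodule.Quotient.mk 1)
  simp only [LinearMap.coe_comp, Function.comp_apply, Submodule.liftQ_apply, hτ1] at h1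
  rw [h1]
  simpa [ψ₀] using hw0

end SelfInjective

/-! ## The central certificate over `ℤ/M` -/

/-- **Central certificate lemma over `ℤ/M`** (registered stub `stub_centralCertificateZMod` of
stmt-PneNP-2659, line `csp-spine-meet-to-join`). `e` maps a `ℤ/M`-module `Zadd` into the centre of
`P`; the quotient instance is solvable through `x₀ = g j * p₀ j * e (ζ₀ j)` (`p₀ j ∈ H j`) but
`⋂ j, g j • H j = ∅`. Then some `ℤ/M`-linear functionals `θ j` kill the central parts of the `H j`,
sum to zero, and sum to one fixed NONZERO value `t` on the decomposition vector of every lift of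
every solution of the quotient instance. [folklore] -/
theorem stub_centralCertificateZMod :
    ∀ (M : ℕ) [NeZero M] (P : Type) [Group P] (Zadd : Type) [AddCommGroup Zadd] [Module (ZMod M) Zadd]
      (e : Multiplicative Zadd →* P) (ι : Type) [Fintype ι] [DecidableEq ι] (H : ι → Subgroup P),
      (∀ z, e z ∈ Subgroup.center P) →
      ∀ (g : ι → P) (x₀ : P) (p₀ : ι → P) (ζ₀ : ι → Zadd), (∀ j, p₀ j ∈ H j) →
        (∀ j, x₀ = g j * p₀ j * e (Multiplicative.ofAdd (ζ₀ j))) →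
        (¬ ∃ y : P, ∀ j, (g j)⁻¹ * y ∈ H j) →
        ∃ (θ : ι → (Zadd →ₗ[ZMod M] ZMod M)) (t : ZMod M), t ≠ 0 ∧
          (∀ j (ζ : Zadd), e (Multiplicative.ofAdd ζ) ∈ H j → θ j ζ = 0) ∧
          (∀ ζ : Zadd, ∑ j, θ j ζ = 0) ∧
          ∀ (x : P) (p : ι → P) (ζ : ι → Zadd), (∀ j, p j ∈ H j) →
            (∀ j, x = g j * p j * e (Multiplicative.ofAdd (ζ j))) → ∑ j, θ j (ζ j) = t := by
  intro M _ P _ Zadd _ _ e ι _ _ H hcen g x₀ p₀ ζ₀ hp₀ hx₀ hunsat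
  -- `Gen`: decomposition vectors of the elements of `⋂ j, H j · e(Zadd)` (an additive submonoid)
  let GenM : AddSubmonoid (ι → Zadd) :=
    { carrier := {t | ∃ w : P, ∃ p : ι → P, (∀ j, p j ∈ H j) ∧ ∀ j, w = p j * e (ofAdd (t j))}
      zero_mem' := ⟨1, fun _ => 1, fun j => (H j).one_mem, fun j => by simp⟩
      add_mem' := by
        rintro t t' ⟨w, p, hp, hw⟩ ⟨w', p', hp', hw'⟩
        refine ⟨w * w', fun j => p j * p' j, fun j => (H j).mul_mem (hp j) (hp' j), fun j => ?_⟩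
        have hc : e (ofAdd (t j)) * p' j = p' j * e (ofAdd (t j)) :=
          ((Subgroup.mem_center_iff.1 (hcen (ofAdd (t j)))) (p' j)).symm
        calc w * w' = p j * e (ofAdd (t j)) * (p' j * e (ofAdd (t' j))) := by rw [hw j, hw' j]
          _ = p j * (e (ofAdd (t j)) * p' j) * e (ofAdd (t' j)) := by group
          _ = p j * (p' j * e (ofAdd (t j))) * e (ofAdd (t' j)) := by rw [hc]
          _ = p j * p' j * (e (ofAdd (t j)) * e (ofAdd (t' j))) := by group
          _ = p j * p' j * e (ofAdd ((t + t') j)) := by rw [← map_mul, ← ofAdd_add, Pi.add_apply] }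
  -- `K`: the diagonal plus the central parts of the `H j`
  let KM : AddSubmonoid (ι → Zadd) :=
    { carrier := {t | ∃ z : Zadd, ∀ j, e (ofAdd (t j + z)) ∈ H j}
      zero_mem' := ⟨0, fun j => by simp [(H j).one_mem]⟩
      add_mem' := by
        rintro t t' ⟨z, hz⟩ ⟨z', hz'⟩
        refine ⟨z + z', fun j => ?_⟩
        have := (H j).mul_mem (hz j) (hz' j)
        rw [← map_mul, ← ofAdd_add] at this
        convert this using 3
        simp only [Pi.add_apply]; abel }
  -- both are `ℤ/M`-submodules: `c • t` is the `c.val`-fold sum of `t`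
  have hsmul : ∀ (S : AddSubmonoid (ι → Zadd)) (c : ZMod M) {t : ι → Zadd}, t ∈ S → c • t ∈ S :=
    fun S c t ht => by
      rw [← ZMod.natCast_zmod_val c, Nat.cast_smul_eq_nsmul]
      exact nsmul_mem ht _
  let Gen : Submodule (ZMod M) (ι → Zadd) := { GenM with smul_mem' := fun c _ ht => hsmul GenM c ht }
  let K : Submodule (ZMod M) (ι → Zadd) := { KM with smul_mem' := fun c _ ht => hsmul KM c ht }
  set W : Submodule (ZMod M) (ι → Zadd) := Gen ⊔ K with hW
  -- unsolvability keeps `ζ₀` out of `W`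
  have hζ₀ : ζ₀ ∉ W := by
    intro hmem
    rw [Submodule.mem_sup] at hmem
    obtain ⟨t, ⟨w, p, hp, hw⟩, κ, ⟨z, hz⟩, htk⟩ := hmem
    apply hunsat
    refine ⟨x₀ * w⁻¹ * e (ofAdd z), fun j => ?_⟩
    have hζ : ζ₀ j = t j + κ j := by rw [← htk]; rfl
    have hcw : w * e (ofAdd (κ j)) = e (ofAdd (κ j)) * w :=
      (Subgroup.mem_center_iff.1 (hcen (ofAdd (κ j)))) w
    have hx : x₀ = g j * p₀ j * (p j)⁻¹ * e (ofAdd (κ j)) * w := by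
      have hw' : e (ofAdd (t j)) = (p j)⁻¹ * w := by rw [hw j]; group
      calc x₀ = g j * p₀ j * e (ofAdd (ζ₀ j)) := hx₀ j
        _ = g j * p₀ j * (e (ofAdd (t j)) * e (ofAdd (κ j))) := by
            rw [hζ, ofAdd_add, map_mul]
        _ = g j * p₀ j * ((p j)⁻¹ * w * e (ofAdd (κ j))) := by rw [hw']
        _ = g j * p₀ j * ((p j)⁻¹ * (e (ofAdd (κ j)) * w)) := by rw [mul_assoc ((p j)⁻¹), hcw]
        _ = g j * p₀ j * (p j)⁻¹ * e (ofAdd (κ j)) * w := by group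
    have : (g j)⁻¹ * (x₀ * w⁻¹ * e (ofAdd z)) = p₀ j * (p j)⁻¹ * e (ofAdd (κ j + z)) := by
      rw [hx, ofAdd_add, map_mul]; group
    rw [this]
    exact (H j).mul_mem ((H j).mul_mem (hp₀ j) ((H j).inv_mem (hp j))) (hz j)
  -- SEPARATION: the class of `ζ₀` in `(ι → Zadd) ⧸ W` is nonzero, hence detected by a functional
  have hq : W.mkQ ζ₀ ≠ 0 := by
    rwa [Ne, Submodule.mkQ_apply, Submodule.Quotient.mk_eq_zero]
  obtain ⟨φ, hφ⟩ := zmod_exists_linearMap_apply_ne_zero (n := M) hq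
  let f : (ι → Zadd) →ₗ[ZMod M] ZMod M := φ ∘ₗ W.mkQ
  have hfW' : ∀ t ∈ W, f t = 0 := fun t ht => by
    change φ (W.mkQ t) = 0
    rw [Submodule.mkQ_apply, (Submodule.Quotient.mk_eq_zero W).2 ht, map_zero]
  refine ⟨fun j => f.comp (LinearMap.single (ZMod M) (fun _ : ι => Zadd) j), f ζ₀, hφ, ?_, ?_, ?_⟩
  · -- (a) central elements of `H j` are killed: `single j ζ ∈ K ⊆ W`
    intro j ζ hζ
    refine hfW' _ (Submodule.mem_sup_right ⟨0, fun i => ?_⟩)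
    by_cases hij : i = j
    · subst hij; simpa using hζ
    · simp [Pi.single_eq_of_ne hij, (H i).one_mem]
  · -- (b) the diagonal is killed: `(fun _ => ζ) ∈ K ⊆ W` with `z = -ζ`
    intro ζ
    have hsum : ∑ j, f.comp (LinearMap.single (ZMod M) (fun _ : ι => Zadd) j) ζ =
        f (∑ j, Pi.single j ζ) := by
      rw [map_sum]; rfl
    rw [hsum, Finset.univ_sum_single]
    refine hfW' _ (Submodule.mem_sup_right ⟨-ζ, fun j => ?_⟩)
    simp [(H j).one_mem]
  · -- (c) every lift of every solution of the quotient instance: `ζ - ζ₀ ∈ Gen ⊆ W`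
    intro x p ζ hp hx
    have hsum : ∑ j, f.comp (LinearMap.single (ZMod M) (fun _ : ι => Zadd) j) (ζ j) = f ζ := by
      rw [show f ζ = f (∑ j, Pi.single j (ζ j)) by rw [Finset.univ_sum_single ζ], map_sum]; rfl
    rw [hsum]
    have hgen : ζ - ζ₀ ∈ W := by
      refine Submodule.mem_sup_left ⟨x₀⁻¹ * x, fun j => (p₀ j)⁻¹ * p j,
        fun j => (H j).mul_mem ((H j).inv_mem (hp₀ j)) (hp j), fun j => ?_⟩
      have hc : (e (ofAdd (ζ₀ j)))⁻¹ * ((p₀ j)⁻¹ * p j) = (p₀ j)⁻¹ * p j * (e (ofAdd (ζ₀ j)))⁻¹ :=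
        ((Subgroup.mem_center_iff.1 ((Subgroup.center P).inv_mem (hcen (ofAdd (ζ₀ j)))))
          ((p₀ j)⁻¹ * p j)).symm
      have hE : (e (ofAdd (ζ₀ j)))⁻¹ * e (ofAdd (ζ j)) = e (ofAdd ((ζ - ζ₀) j)) := by
        rw [← map_inv, ← map_mul, ← ofAdd_neg, ← ofAdd_add, Pi.sub_apply, neg_add_eq_sub]
      calc x₀⁻¹ * x = (g j * p₀ j * e (ofAdd (ζ₀ j)))⁻¹ * (g j * p j * e (ofAdd (ζ j))) := by
            rw [← hx₀ j, ← hx j]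
        _ = (e (ofAdd (ζ₀ j)))⁻¹ * ((p₀ j)⁻¹ * p j) * e (ofAdd (ζ j)) := by group
        _ = (p₀ j)⁻¹ * p j * (e (ofAdd (ζ₀ j)))⁻¹ * e (ofAdd (ζ j)) := by rw [hc]
        _ = (p₀ j)⁻¹ * p j * e (ofAdd ((ζ - ζ₀) j)) := by rw [mul_assoc, hE]
    have : f ζ = f ζ₀ + f (ζ - ζ₀) := by rw [← map_add]; congr 1; abel
    rw [this, hfW' _ hgen, add_zero]

end Summit.PneNP.PneNP.Cruxes.Capture.CspSpineMeetToJoin
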